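import Literature.AlgebraicGeometry.Resolution.RegularHomLocalization
import Literature.AlgebraicGeometry.Resolution.SpreadingOutAlgebra
import Mathlib.RingTheory.AdicCompletion.AsTensorProduct
import Mathlib.RingTheory.Flat.FaithfullyFlat.Basic
import HarnessLib

/-!
# The completed chain of a `τ = 1` near chain: transfer of the ring-side contract clauses to the adic completions
# (CoP1 Prop. 4.4 / CJS Thm. 8.24: "complete once"; N2-endgame brick B2)

Topic: `Literature/AlgebraicGeometry/Resolution`. [CoP1] = Cossart–Piltant, J. Algebra 320 (2008), proof of Prop. 4.4, p. 11 ("the existence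
of a regular (possibly formal) curve `Γ`") and Cossart–Jannsen–Saito, LNM 2270, Thm. 8.24 (preparation in the complete case). Cell res-hironaka,
F-71 τ = 1 engine, N2-endgame design `plan/inputs/N2-ENDGAME-DESIGN-p7b-v0.md` (res-inputs-p-7b), architecture (B) «complete ONCE at the
start», brick B2 «the completed chain» (seat res-inputs-p-8a g2, critic R61). For a local homomorphism `φ : R → S` of Noetherian local rings,
`ι_R : R → R̂ = AdicCompletion 𝔪_R R`, `ι_S : S → Ŝ`, and the completed map `φ̂ = adicCompletionMap 𝔪_R 𝔪_S φ` (`AdicQuotient.lean`), the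
clauses of the ring-side contract §1 of the design pass from `(R, S, φ, I, I′, u)` to `(R̂, Ŝ, φ̂, I R̂, I′ Ŝ, ι_R u)`:

* `map_adicCompletionMap_map` — `(I R̂) Ŝ = (I S) Ŝ` (`φ̂ ∘ ι_R = ι_S ∘ φ`);
* `map_le_pow_maximalIdeal_adicCompletion` — near: `I′ ⊆ 𝔪_S^μ ⇒ I′Ŝ ⊆ 𝔪_Ŝ^μ`;
* `weakTransform_adicCompletion_of_le`, `weakTransform_adicCompletion_of_eq` — weak transform, INCLUSION form `(I S : φ u^μ) ⊆ I′ ⇒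
  ((I R̂)Ŝ : φ̂ û^μ) ⊆ I′Ŝ` and EQUALITY form `I′ = (I S : φ u^μ) ⇒ I′Ŝ = ((I R̂)Ŝ : φ̂ û^μ)` — colon ideals by a principal set commute with
  the FLAT base change `S → Ŝ` (Matsumura 7.4 (iii), tree `map_colon_singleton_of_flat`; `Ŝ` flat: Mathlib);
* `not_map_le_pow_maximalIdeal_adicCompletion` — order: `I ⊄ 𝔪_R^{μ+1} ⇒ I R̂ ⊄ 𝔪_R̂^{μ+1}` (`J R̂ ∩ R = J`, faithful flatness,
  Matsumura 8.14 / 7.5);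
* `map_maximalIdeal_adicCompletionMap_eq_span` — u-chart: `𝔪_R S = (φ u) ⇒ 𝔪_R̂ Ŝ = (φ̂ û)`;
* `isLocalHom_adicCompletionMap'`, `residueField_map_adicCompletionMap_surjective` — rational: `k(R) ↠ k(S) ⇒ k(R̂) ↠ k(Ŝ)`;
* `adicCompletionMap_mem_span_mul_maximalIdeal` — S1: `φ y ∈ (φ u)·𝔪_S ⇒ φ̂ ŷ ∈ (φ̂ û)·𝔪_Ŝ`;
* `span_range_algebraMap_adicCompletion_eq_maximalIdeal` — a regular system of parameters of `R` stays one of `R̂` (`𝔪_R R̂ = 𝔪_R̂`).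

The colon / flat base change lemma itself (design §4 R1) and the flatness of `R → R̂` are NOT restated (tree `Ideal.map_colon_of_flat`,
`map_colon_singleton_of_flat`; Mathlib `AdicCompletion.flat_of_isNoetherian`); the transfer of `τ` / `cl_μ` / isolation is p-7b's B0/B1.
No definitions, no named facts. `CossartPiltant2008_prop44` is NOT proved; resolution in dimension `≥ 4` / positive characteristic is NOT proved.

## Sources

* V. Cossart, O. Piltant, J. Algebra 320 (2008), Prop. 4.4 (proof, p. 11). [CossartPiltant2008]
* V. Cossart, U. Jannsen, S. Saito, LNM 2270 (2020), Thm. 8.24. [CossartJannsenSaito2020]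
* H. Matsumura, *Commutative Ring Theory* (1986), Thm. 7.4 (iii), Thm. 7.5 (ii), Thm. 8.14. [Matsumura1987]
-/

noncomputable section

open IsLocalRing AdicCompletion

namespace Literature.AlgebraicGeometry.Resolution

universe u

section Transfer

variable {R S : Type u} [CommRing R] [CommRing S] [IsLocalRing R] [IsLocalRing S] [IsNoetherianRing R] [IsNoetherianRing S]
  (φ : R →+* S) (hφ : (maximalIdeal R).map φ ≤ maximalIdeal S)

omit [IsNoetherianRing R] [IsNoetherianRing S] in
/-- `φ̂ ∘ ι_R = ι_S ∘ φ` (functoriality of the `𝔪`-adic completion). [cite: Matsumura1987, §8 (p. 57), Thm. 8.1] -/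
theorem adicCompletionMap_comp_algebraMap' : (adicCompletionMap (maximalIdeal R) (maximalIdeal S) φ hφ).comp (algebraMap R (AdicCompletion (maximalIdeal R) R)) =
      (algebraMap S (AdicCompletion (maximalIdeal S) S)).comp φ := by
  refine RingHom.ext fun r => ?_
  simp only [RingHom.comp_apply, AdicCompletion.algebraMap_apply, Algebra.algebraMap_self, RingHom.id_apply,
    adicCompletionMap_of]

omit [IsNoetherianRing R] [IsNoetherianRing S] in
/-- **`(I R̂) Ŝ = (I S) Ŝ`**: extending an ideal of `R` to `Ŝ` through `R̂` or through `S` gives the same ideal. [cite: Matsumura1987, Thm. 8.1] -/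
theorem map_adicCompletionMap_map (I : Ideal R) : (I.map (algebraMap R (AdicCompletion (maximalIdeal R) R))).map (adicCompletionMap (maximalIdeal R) (maximalIdeal S) φ hφ) =
      (I.map φ).map (algebraMap S (AdicCompletion (maximalIdeal S) S)) := by
  rw [Ideal.map_map, Ideal.map_map, adicCompletionMap_comp_algebraMap' φ hφ]

omit [IsNoetherianRing R] [IsNoetherianRing S] in
/-- `φ̂ (ι_R r) = ι_S (φ r)`. [cite: Matsumura1987, Thm. 8.1] -/
theorem adicCompletionMap_algebraMap (r : R) :
    adicCompletionMap (maximalIdeal R) (maximalIdeal S) φ hφ (algebraMap R (AdicCompletion (maximalIdeal R) R) r) =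
      algebraMap S (AdicCompletion (maximalIdeal S) S) (φ r) := by
  have h := congrArg (fun g : R →+* AdicCompletion (maximalIdeal S) S => g r) (adicCompletionMap_comp_algebraMap' φ hφ)
  simpa using h

omit [IsNoetherianRing R] in
/-- **Near-ness passes to the completion**: `I′ ⊆ 𝔪_S^μ ⇒ I′Ŝ ⊆ 𝔪_Ŝ^μ` (`𝔪_Ŝ = 𝔪_S Ŝ`, Matsumura Thm. 8.11). [cite: Matsumura1987, Thm. 8.11] -/
theorem map_le_pow_maximalIdeal_adicCompletion {I' : Ideal S} {μ : ℕ} (h : I' ≤ maximalIdeal S ^ μ) :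
    I'.map (algebraMap S (AdicCompletion (maximalIdeal S) S)) ≤ maximalIdeal (AdicCompletion (maximalIdeal S) S) ^ μ := by
  rw [AdicCompletion.maximalIdeal_eq_map, ← Ideal.map_pow]
  exact Ideal.map_mono h

omit [IsNoetherianRing R] in
/-- **The weak-transform clause passes to the completion (inclusion form)**: if every `g ∈ S` with `φ(u)^μ g ∈ I S` lies in `I′`,
then every `ĝ ∈ Ŝ` with `φ̂(û)^μ ĝ ∈ (I R̂) Ŝ` lies in `I′ Ŝ` — colon by a principal set commutes with the flat base change `S → Ŝ`
(Matsumura 7.4 (iii)). [cite: Matsumura1987, Thm. 7.4 (iii)] -/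
theorem weakTransform_adicCompletion_of_le {I : Ideal R} {I' : Ideal S} {u : R} {μ : ℕ}
    (h : ∀ g : S, φ u ^ μ * g ∈ I.map φ → g ∈ I') (g : AdicCompletion (maximalIdeal S) S)
    (hg : adicCompletionMap (maximalIdeal R) (maximalIdeal S) φ hφ (algebraMap R (AdicCompletion (maximalIdeal R) R) u) ^ μ * g ∈
      (I.map (algebraMap R (AdicCompletion (maximalIdeal R) R))).map (adicCompletionMap (maximalIdeal R) (maximalIdeal S) φ hφ)) :
    g ∈ I'.map (algebraMap S (AdicCompletion (maximalIdeal S) S)) := by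
  have hle : (I.map φ).colon {φ u ^ μ} ≤ I' := by
    intro s hs
    refine h s ?_
    have hs' := Submodule.mem_colon_singleton.mp hs
    rw [smul_eq_mul, mul_comm] at hs'
    exact hs'
  rw [map_adicCompletionMap_map φ hφ, adicCompletionMap_algebraMap φ hφ, ← map_pow] at hg
  have hmem : g ∈ ((I.map φ).map (algebraMap S (AdicCompletion (maximalIdeal S) S))).colon
      {algebraMap S (AdicCompletion (maximalIdeal S) S) (φ u ^ μ)} := by
    refine Submodule.mem_colon_singleton.mpr ?_
    rw [smul_eq_mul, mul_comm]
    exact hg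
  rw [← map_colon_singleton_of_flat (I.map φ) (φ u ^ μ) (AdicCompletion (maximalIdeal S) S)] at hmem
  exact Ideal.map_mono hle hmem

omit [IsNoetherianRing R] in
/-- **The weak-transform clause passes to the completion (equality form)**: `I′ = (I S : φ u^μ) ⇒ I′ Ŝ = ((I R̂) Ŝ : φ̂ û^μ)`.
[cite: Matsumura1987, Thm. 7.4 (iii)] -/
theorem weakTransform_adicCompletion_of_eq {I : Ideal R} {I' : Ideal S} {u : R} {μ : ℕ}
    (h : I' = (I.map φ).colon {φ u ^ μ}) :
    I'.map (algebraMap S (AdicCompletion (maximalIdeal S) S)) =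
      ((I.map (algebraMap R (AdicCompletion (maximalIdeal R) R))).map (adicCompletionMap (maximalIdeal R) (maximalIdeal S) φ hφ)).colon
        {adicCompletionMap (maximalIdeal R) (maximalIdeal S) φ hφ (algebraMap R (AdicCompletion (maximalIdeal R) R) u) ^ μ} := by
  rw [h, map_colon_singleton_of_flat (I.map φ) (φ u ^ μ) (AdicCompletion (maximalIdeal S) S), map_adicCompletionMap_map φ hφ,
    ← map_pow, adicCompletionMap_algebraMap φ hφ, map_pow, map_pow]

omit [IsNoetherianRing S] in
/-- **"Order exactly `μ`" passes to the completion**: `I ⊄ 𝔪_R^{μ+1} ⇒ I R̂ ⊄ 𝔪_R̂^{μ+1}` (`J R̂ ∩ R = J` for every ideal `J`, as `R̂` is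
faithfully flat over the local ring `R`). [cite: Matsumura1987, Thm. 8.14 with Thm. 7.5 (ii)] -/
theorem not_map_le_pow_maximalIdeal_adicCompletion {I : Ideal R} {k : ℕ} (h : ¬ I ≤ maximalIdeal R ^ k) :
    ¬ I.map (algebraMap R (AdicCompletion (maximalIdeal R) R)) ≤ maximalIdeal (AdicCompletion (maximalIdeal R) R) ^ k := by
  intro hle
  apply h
  haveI : Module.FaithfullyFlat R (AdicCompletion (maximalIdeal R) R) := Module.FaithfullyFlat.of_flat_of_isLocalHom
  have h1 : I ≤ ((maximalIdeal R ^ k).map (algebraMap R (AdicCompletion (maximalIdeal R) R))).comap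
      (algebraMap R (AdicCompletion (maximalIdeal R) R)) := by
    rw [← Ideal.map_le_iff_le_comap, Ideal.map_pow, ← AdicCompletion.maximalIdeal_eq_map]
    exact hle
  rwa [Ideal.comap_map_eq_self_of_faithfullyFlat] at h1


/-- **The completed map of a local homomorphism is local** (`φ̂ (𝔪_R̂) ⊆ 𝔪_Ŝ`; RingHom form of the tree's
`isLocalHom_adicCompletionMap`). [cite: Matsumura1987, Thm. 8.11] -/
theorem isLocalHom_adicCompletionMap' : IsLocalHom (adicCompletionMap (maximalIdeal R) (maximalIdeal S) φ hφ) := by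
  apply ((IsLocalRing.local_hom_TFAE _).out 0 2).mpr
  rw [AdicCompletion.maximalIdeal_eq_map, AdicCompletion.maximalIdeal_eq_map, Ideal.map_map,
    adicCompletionMap_comp_algebraMap' φ hφ, ← Ideal.map_map]
  exact Ideal.map_mono hφ

/-- **The «rational» clause passes to the completion**: if `φ` is residually onto (`k(R) → k(S)` surjective), so is `φ̂` — the residue
fields of `R̂`, `Ŝ` are those of `R`, `S` (Matsumura Thm. 8.11: `R̂/𝔪R̂ = R/𝔪`). [cite: Matsumura1987, Thm. 8.11] -/
theorem residueField_map_adicCompletionMap_surjective [IsLocalHom φ]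
    (h : Function.Surjective (ResidueField.map φ)) :
    haveI := isLocalHom_adicCompletionMap' φ hφ
    Function.Surjective (ResidueField.map (adicCompletionMap (maximalIdeal R) (maximalIdeal S) φ hφ)) := by
  haveI := isLocalHom_adicCompletionMap' φ hφ
  intro z
  -- `z` comes from `S`, `S` from `R` modulo `𝔪`, and `R` maps into `R̂`
  obtain ⟨y, rfl⟩ := (AdicCompletion.residueField_map_bijective S).2 z
  obtain ⟨x, rfl⟩ := h y
  obtain ⟨r, rfl⟩ := IsLocalRing.residue_surjective x
  refine ⟨ResidueField.map (algebraMap R (AdicCompletion (maximalIdeal R) R)) (residue R r), ?_⟩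
  simp only [ResidueField.map_residue, adicCompletionMap_algebraMap φ hφ]

omit [IsNoetherianRing S] in
/-- **The `u`-chart clause passes to the completion**: `𝔪_R S = (φ u) ⇒ 𝔪_R̂ Ŝ = (φ̂ û)` (`𝔪_R̂ = 𝔪_R R̂`). [cite: Matsumura1987, Thm. 8.11] -/
theorem map_maximalIdeal_adicCompletionMap_eq_span {u : R} (h : (maximalIdeal R).map φ = Ideal.span {φ u}) :
    (maximalIdeal (AdicCompletion (maximalIdeal R) R)).map (adicCompletionMap (maximalIdeal R) (maximalIdeal S) φ hφ) =
      Ideal.span {adicCompletionMap (maximalIdeal R) (maximalIdeal S) φ hφ (algebraMap R (AdicCompletion (maximalIdeal R) R) u)} := by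
  rw [AdicCompletion.maximalIdeal_eq_map, map_adicCompletionMap_map φ hφ, h, Ideal.map_span, Set.image_singleton,
    adicCompletionMap_algebraMap φ hφ]

omit [IsNoetherianRing R] in
/-- **The S1 clause passes to the completion**: `φ y ∈ (φ u)·𝔪_S ⇒ φ̂ ŷ ∈ (φ̂ û)·𝔪_Ŝ` (`𝔪_Ŝ = 𝔪_S Ŝ`). [cite: Matsumura1987, Thm. 8.11] -/
theorem adicCompletionMap_mem_span_mul_maximalIdeal {y u : R} (h : φ y ∈ Ideal.span {φ u} * maximalIdeal S) :
    adicCompletionMap (maximalIdeal R) (maximalIdeal S) φ hφ (algebraMap R (AdicCompletion (maximalIdeal R) R) y) ∈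
      Ideal.span {adicCompletionMap (maximalIdeal R) (maximalIdeal S) φ hφ (algebraMap R (AdicCompletion (maximalIdeal R) R) u)} *
        maximalIdeal (AdicCompletion (maximalIdeal S) S) := by
  rw [adicCompletionMap_algebraMap φ hφ, adicCompletionMap_algebraMap φ hφ, AdicCompletion.maximalIdeal_eq_map,
    ← Set.image_singleton, ← Ideal.map_span, ← Ideal.map_mul]
  exact Ideal.mem_map_of_mem _ h

omit [IsNoetherianRing S] in
/-- **A regular system of parameters of `R` generates `𝔪_R̂`**: `(c) = 𝔪_R ⇒ (ι_R ∘ c) = 𝔪_R̂` (`𝔪_R R̂ = 𝔪_R̂`). [cite: Matsumura1987, Thm. 8.11] -/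
theorem span_range_algebraMap_adicCompletion_eq_maximalIdeal {ι' : Type*} {c : ι' → R}
    (h : Ideal.span (Set.range c) = maximalIdeal R) :
    Ideal.span (Set.range ((algebraMap R (AdicCompletion (maximalIdeal R) R)) ∘ c)) = maximalIdeal (AdicCompletion (maximalIdeal R) R) := by
  rw [Set.range_comp, ← Ideal.map_span, h, AdicCompletion.maximalIdeal_eq_map]

omit [IsNoetherianRing R] [IsNoetherianRing S] in
/-- **An ideal generated by elements of `R` extends to the ideal generated by their images**: `(span T) R̂ = span (ι_R T)` (for the
curve-step centre `P = (y, u)`: `P R̂ = (ŷ, û)`). [cite: Matsumura1987, Thm. 8.1] -/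
theorem map_span_algebraMap_adicCompletion (T : Set R) :
    (Ideal.span T).map (algebraMap R (AdicCompletion (maximalIdeal R) R)) =
      Ideal.span ((algebraMap R (AdicCompletion (maximalIdeal R) R)) '' T) :=
  Ideal.map_span _ T

end Transfer

end Literature.AlgebraicGeometry.Resolution

end
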